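import Literature.Computability.MetaComplexity.ParityDNF
import Literature.Computability.MetaComplexity.DepthFregeLocalChain
import Literature.Computability.MetaComplexity.XorPHPLabelling
import HarnessLib

/-!
# Gaussian width and bounded-depth Frege, I: the rows and the chain along a refutation

Second layer (after `ParityDNF.lean`, `DepthFregeLocalChain.lean`) of the bounded-depth Frege
UPPER bound through Gaussian width (`GaussianWidthDepthFregeUpperBound.lean`). For a system
`E : Fin m → LinEqMod 2 n` with `ℓ`-sparse rows and its parity CNF `T = sumEncoding 1 E`,
`F = PropForm.ofCNF T`:

* `rowS` — **each row's parity DNF is derivable**: `⊢ parityForm (E e), ¬F` (clause extraction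
  from `F`, one truth table over the `≤ ℓ` variables of the row against its `≤ 2^ℓ` clauses,
  and `2^ℓ` cuts), with an explicit line count `rowLines`;
* `rowsFoldS` — `⊢ ⋀_e parityForm (E e), ¬F` (conjunction introduction, row by row);
* `derived E L k`, `state E L k` — along a Gaussian derivation `L : Fin (t+1) → LinEqMod 2 n`,
  the DISTINCT derived equations among the first `k` lines (duplicates and rows skipped) and the
  list "derived ++ rows" whose parity DNFs form the carried conjunction; at most `2 (n+1)^w`
  equations are ever derived when all lines have `≤ w` variables (`length_derived_le`);
* `chainS` — the carried line `⊢ ⋀ (state k).map parityForm, ¬F` for every `k ≤ t + 1`, each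
  genuinely new line costing `stepLines P Q N` lines (`DepthFregeLocalChain.chainLocalS`: the new
  parity is implied by at most two parities already in the conjunction, over `≤ 2w` variables).

All statements are proved; line counts are explicit. The construction is the folklore
simulation described in the docstring of
`Summit.PneNP.PneNP.Theses.MatroidTseitin.GaussianWidthDepthFregeUB` ("deduplicate derived
equations, write each as a DNF, derive each XOR step by case analysis over `≤ 2w` variables").

References: E. Ben-Sasson, R. Impagliazzo, Comput. Complexity 19 (2010) (Gaussian width);
N. Galesi, D. Itsykson, A. Riazanov, A. Sofronova, APAL 174 (2023), Lemma 4, §4.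
-/

namespace Literature.Computability.MetaComplexity

open Complexity Complexity.PropForm TextbookFrege KrajicekRamsey Finset

/-! ### Clause formulas: value (local copy; size and variables are `OntoPHPReduction.size_clauseOf_le`,
`OntoPHPReduction.exists_of_mem_vars_clauseOf` of `XorPHPLabelling.lean`) -/

namespace TextbookFrege

/-- The formula of a clause has the value of the clause. [folklore] -/
theorem eval_clauseOf' (σ : ℕ → Bool) (c : Clause ℕ) : (clauseOf c).eval σ = c.eval σ := by
  induction c with
  | nil => rfl
  | cons l c ih =>
    have e : clauseOf (l :: c) = disj (litOf l) (clauseOf c) := rfl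
    rw [e, PropForm.eval, ih, eval_litOf']
    rfl

end TextbookFrege

/-! ### The parity CNF of a system: clauses, size -/

section Encoding

variable {m n : ℕ}

/-- A canonical CNF on `V` has at most `2^{|V|}` clauses. [folklore] -/
theorem length_canonicalCNF_le (V : List ℕ) (P : List ℕ → Bool) :
    (canonicalCNF V P).length ≤ 2 ^ V.length := by
  rw [canonicalCNF, List.length_map, ← List.length_sublists]
  exact List.length_filter_le _ _

/-- The clauses of one row belong to the parity CNF of the system. [folklore] -/
theorem mem_sumEncoding_of_mem_equationCNF (E : Fin m → LinEqMod 2 n) (e : Fin m) {c : Clause ℕ}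
    (hc : c ∈ equationCNF 1 (E e)) : c ∈ sumEncoding 1 E := by
  simp only [sumEncoding, List.mem_flatMap, List.mem_finRange, true_and]
  exact ⟨e, hc⟩

/-- A row with `≤ ℓ` variables contributes at most `2^ℓ` clauses. [folklore] -/
theorem length_equationCNF_one_le {ℓ : ℕ} (q : LinEqMod 2 n) (hq : q.supp.card ≤ ℓ) :
    (equationCNF 1 q).length ≤ 2 ^ ℓ := by
  refine (length_canonicalCNF_le _ _).trans ?_
  rw [length_eqVars_one]
  exact Nat.pow_le_pow_right (by norm_num) hq

/-- A clause of a row with `≤ ℓ` variables has `≤ ℓ` literals. [folklore] -/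
theorem length_of_mem_equationCNF_le {ℓ : ℕ} {q : LinEqMod 2 n} (hq : q.supp.card ≤ ℓ)
    {c : Clause ℕ} (hc : c ∈ equationCNF 1 q) : c.length ≤ ℓ := by
  rw [equationCNF] at hc
  rw [length_of_mem_canonicalCNF hc, length_eqVars_one]
  exact hq

/-- The member sum of the rendered clauses of the parity CNF of an `ℓ`-sparse system with `m`
rows is at most `m 2^ℓ (3ℓ + 2)`. [folklore] -/
theorem msum_sumEncoding_le {ℓ : ℕ} (E : Fin m → LinEqMod 2 n) (hE : ∀ e, (E e).supp.card ≤ ℓ) :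
    msum ((sumEncoding 1 E).map clauseOf) ≤ m * (2 ^ ℓ * (3 * ℓ + 2)) := by
  unfold sumEncoding
  have key : ∀ es : List (Fin m),
      msum ((es.flatMap fun k => equationCNF 1 (E k)).map clauseOf) ≤
        es.length * (2 ^ ℓ * (3 * ℓ + 2)) := by
    intro es
    induction es with
    | nil => simp
    | cons e es ih =>
      rw [List.flatMap_cons, List.map_append, msum_append, List.length_cons]
      have h1 : msum ((equationCNF 1 (E e)).map clauseOf) ≤ 2 ^ ℓ * (3 * ℓ + 2) := by
        have hl := length_equationCNF_one_le (E e) (hE e)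
        have hm := msum_le_length_mul (L := (equationCNF 1 (E e)).map clauseOf) (W := 3 * ℓ + 2)
          fun X hX => by
            obtain ⟨c, hc, rfl⟩ := List.mem_map.1 hX
            have h1 := OntoPHPReduction.size_clauseOf_le c
            have h2 := length_of_mem_equationCNF_le (hE e) hc
            nlinarith
        rw [List.length_map] at hm
        exact hm.trans (Nat.mul_le_mul_right _ hl)
      nlinarith
  have h := key (List.finRange m)
  rwa [List.length_finRange] at h

/-- The size of the rendered parity CNF of an `ℓ`-sparse system. [folklore] -/
theorem size_ofCNF_sumEncoding_le {ℓ : ℕ} (E : Fin m → LinEqMod 2 n) (hE : ∀ e, (E e).supp.card ≤ ℓ) :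
    (PropForm.ofCNF (sumEncoding 1 E)).size ≤ m * (2 ^ ℓ * (3 * ℓ + 2)) + 1 := by
  rw [ofCNF_eq_conjList, size_conjList_eq_msum]
  have := msum_sumEncoding_le E hE
  omega

end Encoding

/-! ### The rows -/

section Rows

variable {D B m n ℓ : ℕ}

namespace TextbookFrege

/-- **A doubly negated clause of a CNF in a context**: for a clause `c` of `T` and any context `L`,
`⊢ ¬¬C, L` (`C` the rendered clause): clause extraction `⊢ ¬⋀T, C`, exchange, `¬¬`-introduction
and weakening. [Shoenfield 1967, §3.1] [folklore] -/
theorem negNegClauseS {T : CNF ℕ} {c : Clause ℕ} (hc : c ∈ T) {F : PropForm ℕ}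
    (hF : PropForm.ofCNF T = F) {k : ℕ} (hck : ∀ c' ∈ T, List.length c' ≤ k)
    (L : List (PropForm ℕ)) {NL p : ℕ} (hL : L.length + 1 ≤ NL) (hFL : neg F ∈ L)
    (hLdd : ∀ X ∈ L, X.dd ≤ p) (hp5 : 5 ≤ p) (hD : p + 4 ≤ D)
    (hB : 12 * F.size + 4 * msum L + 20 * k + 50 ≤ B) :
    BD D B (130 * (F.size + 2) + 50 * (NL + 1) ^ 2 + 456) (disjList (neg (neg (clauseOf c)) :: L)) := by
  have hcsize : (clauseOf c).size ≤ 3 * k + 1 := by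
    have h1 := OntoPHPReduction.size_clauseOf_le c
    have h2 := hck c hc
    nlinarith
  have hcdd : (clauseOf c).dd ≤ 1 := dd_clauseOf_le c
  have hc1 := altDepthAux_le_dd_succ 1 (clauseOf c)
  have hFsz : msum (T.map clauseOf) + 1 = F.size := by
    rw [← hF, ofCNF_eq_conjList, size_conjList_eq_msum]
  have hddnF : (neg F).dd ≤ 4 := by rw [← hF]; exact dd_neg_ofCNF_le _
  have hF1 := altDepthAux_le_dd_succ 1 (neg F)
  have hFmsum : F.size + 1 < msum L := by
    have h := size_lt_msum hFL
    simpa only [size] using h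
  have hLpos : 1 ≤ L.length := List.length_pos_of_mem hFL
  -- `⊢ ¬F, C`
  have ex : BD D B (130 * (F.size + 2)) (disjList [neg F, clauseOf c]) := by
    have h := clauseExtractS hc (N := F.size + 2) (D := D) (B := B) (by omega) (by omega) (by omega)
    rwa [hF] at h
  -- `⊢ C, ¬F`, then `⊢ ¬¬C, ¬F`
  have ex₁ : BD D B (130 * (F.size + 2) + 450) (disjList [clauseOf c, neg F]) :=
    subsetN (N := 2) ex (by
        intro X hX; simp only [List.mem_cons, List.not_mem_nil, or_false] at hX ⊢; tauto)
      (p := 4) (by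
        intro X hX; simp only [List.mem_cons, List.not_mem_nil, or_false] at hX
        rcases hX with rfl | rfl
        · exact hcdd.trans (by norm_num)
        · exact hddnF) (by omega) (by
        simp only [size_disjList_cons, size_disjList_nil, size] at hFmsum ⊢; omega) (by simp) (by simp)
  have ex₂ : BD D B (130 * (F.size + 2) + 450 + 6) (disjList [neg (neg (clauseOf c)), neg F]) :=
    consNegNegS ex₁ (by rw [dd_neg]; omega)
      (by rw [disjList_cons, disjList_nil, dd_neg, altDepthAux_one_disj, dd_const]; omega)
      (by simp only [size_disjList_cons, size_disjList_nil, size] at hFmsum ⊢; omega)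
  -- weaken into place
  have harith : 130 * (F.size + 2) + 450 + 6 + 50 * (NL + 1) ^ 2 ≤
      130 * (F.size + 2) + 50 * (NL + 1) ^ 2 + 456 := le_of_eq (by ring)
  refine (subsetN (N := NL) ex₂ ?_ (L' := neg (neg (clauseOf c)) :: L) (p := p) ?_ hD ?_
    (by simp only [List.length_cons, List.length_nil]; omega) (by rw [List.length_cons]; omega)).mono
    harith
  · intro X hX
    simp only [List.mem_cons, List.not_mem_nil, or_false] at hX
    rcases hX with rfl | rfl
    · exact List.mem_cons_self
    · exact List.mem_cons_of_mem _ hFL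
  · intro X hX
    rcases List.mem_cons.1 hX with rfl | hX
    · rw [dd_neg, altDepthAux_one_neg]; omega
    · exact hLdd X hX
  · simp only [size_disjList_eq_msum, msum_cons, msum_nil, size] at hFmsum ⊢
    omega

end TextbookFrege

namespace GaussFrege

/-- The line count of the derivation of one row's parity DNF (`rowS`), in terms of the row width
`ℓ`, a size bound `P` on parity DNFs and the size `SF` of the rendered CNF. [folklore] -/
def rowLines (ℓ P SF : ℕ) : ℕ :=
  2 ^ ℓ * ((P + 1 + 2 ^ ℓ * (3 * ℓ + 4)) * (100 * (ℓ + 8) ^ 2) + 50 * (ℓ + 2 ^ ℓ + 4) ^ 2 + 2) +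
    50 * (2 ^ ℓ + 4) ^ 2 + 2 ^ ℓ * (130 * (SF + 2) + 50 * (2 ^ ℓ + 4) ^ 2 + 458)

variable (E : Fin m → LinEqMod 2 n)

/-- **A row's parity DNF is derivable from the parity CNF**: `⊢ parityForm (E e), ¬F` for
`F = ofCNF (sumEncoding 1 E)`, in `≤ rowLines ℓ P F.size` lines of disjunct depth `≤ D` (`D ≥ 16`)
and size `≤ B`: the tautological sequent "the clauses of row `e` imply its parity DNF" over the
`≤ ℓ` variables of the row (`tautSeqW`), its `≤ 2^ℓ` negated clauses cut away against the clause
extractions `⊢ ¬F, C` (`clauseExtractS`). [cite: GalesiEtAl2023, Lemma 4, §4] -/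
theorem rowS {P : ℕ} (hE : ∀ e, (E e).supp.card ≤ ℓ) (hP : 2 ^ ℓ * (3 * ℓ + 2) + 1 ≤ P)
    (hD : 16 ≤ D)
    (hB : 40 * (P + 2 ^ ℓ * (3 * ℓ + 4) + ℓ) + 16 * (PropForm.ofCNF (sumEncoding 1 E)).size + 600 ≤ B)
    (e : Fin m) :
    BD D B (rowLines ℓ P (PropForm.ofCNF (sumEncoding 1 E)).size)
      (disjList [parityForm (E e), neg (PropForm.ofCNF (sumEncoding 1 E))]) := by
  have hqℓ : (E e).supp.card ≤ ℓ := hE e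
  -- the parity DNF `A` of the row
  have hAsize : (parityForm (E e)).size ≤ P := (size_parityForm_le_of_le hqℓ).trans hP
  have hAdd : (parityForm (E e)).dd ≤ 3 := dd_parityForm_le _
  have hAdepth : (parityForm (E e)).altDepth ≤ 3 := altDepth_parityForm_le _
  have hAvars : ∀ x ∈ (parityForm (E e)).vars, x ∈ eqVars 1 (E e) := fun x hx => mem_vars_parityForm hx
  have hAeval : ∀ τ : ℕ → Bool, (∀ c ∈ equationCNF 1 (E e), c.eval τ = true) →
      (parityForm (E e)).eval τ = true := by
    intro τ hall
    rw [eval_parityForm_eq_true_iff]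
    have h1 : (equationCNF 1 (E e)).eval τ = true := (CNF.eval_eq_true_iff _ _).2 hall
    rw [eval_equationCNF] at h1
    exact of_decide_eq_true h1
  generalize hA : parityForm (E e) = A at hAsize hAdd hAdepth hAvars hAeval ⊢
  -- the variable list `V` and the clause list `Lc` of the row
  have hVnd : (eqVars 1 (E e)).Nodup := nodup_eqVars 1 (E e)
  have hVlen : (eqVars 1 (E e)).length ≤ ℓ := by rw [length_eqVars_one]; exact hqℓ
  have hLclen : (equationCNF 1 (E e)).length ≤ 2 ^ ℓ := length_equationCNF_one_le (E e) hqℓ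
  have hLcT : ∀ c ∈ equationCNF 1 (E e), c ∈ sumEncoding 1 E :=
    fun c hc => mem_sumEncoding_of_mem_equationCNF E e hc
  have hLcvars : ∀ c ∈ equationCNF 1 (E e), ∀ l ∈ c, l.1 ∈ eqVars 1 (E e) := by
    intro c hc l hl
    rw [equationCNF] at hc
    exact fst_mem_of_mem_canonicalCNF hc hl
  generalize hV : eqVars 1 (E e) = V at hVnd hVlen hAvars hLcvars
  generalize hLc : equationCNF 1 (E e) = Lc at hLclen hLcT hLcvars hAeval
  -- the rendered CNF `F`
  have hTk : ∀ c' ∈ sumEncoding 1 E, List.length c' ≤ ℓ := by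
    intro c' hc'
    simp only [sumEncoding, List.mem_flatMap, List.mem_finRange, true_and] at hc'
    obtain ⟨k, hk⟩ := hc'
    exact length_of_mem_equationCNF_le (hE k) hk
  have hddnF : (neg (PropForm.ofCNF (sumEncoding 1 E))).dd ≤ 4 := dd_neg_ofCNF_le _
  generalize hF : PropForm.ofCNF (sumEncoding 1 E) = F at hddnF hB ⊢
  have hF1 := altDepthAux_le_dd_succ 1 (neg F)
  -- the negated clauses of the row
  have hXslen : (Lc.map fun c => neg (clauseOf c)).length ≤ 2 ^ ℓ := by
    rw [List.length_map]; exact hLclen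
  have hXmem : ∀ X ∈ Lc.map (fun c => neg (clauseOf c)), ∃ c ∈ Lc, X = neg (clauseOf c) := by
    intro X hX
    obtain ⟨c, hc, rfl⟩ := List.mem_map.1 hX
    exact ⟨c, hc, rfl⟩
  have hXtaut : ∀ τ : ℕ → Bool, (∃ X ∈ Lc.map (fun c => neg (clauseOf c)), X.eval τ = true) ∨
      A.eval τ = true := by
    intro τ
    by_cases hall : ∀ c ∈ Lc, c.eval τ = true
    · exact Or.inr (hAeval τ hall)
    · push Not at hall
      obtain ⟨c, hc, hcτ⟩ := hall
      refine Or.inl ⟨neg (clauseOf c), List.mem_map.2 ⟨c, hc, rfl⟩, ?_⟩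
      simp [PropForm.eval, eval_clauseOf', hcτ]
  generalize hXs : Lc.map (fun c => neg (clauseOf c)) = Xs at hXslen hXmem hXtaut
  have hXsize : ∀ X ∈ Xs, X.size ≤ 3 * ℓ + 2 := by
    intro X hX
    obtain ⟨c, hc, rfl⟩ := hXmem X hX
    have h1 := OntoPHPReduction.size_clauseOf_le c
    have h2 := hTk c (hLcT c hc)
    simp only [size]; nlinarith
  have hXdd : ∀ X ∈ Xs, X.dd ≤ 3 := by
    intro X hX
    obtain ⟨c, -, rfl⟩ := hXmem X hX
    exact dd_neg_clauseOf_le c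
  have hmsumXs : msum Xs ≤ 2 ^ ℓ * (3 * ℓ + 3) := by
    have h := msum_le_length_mul (L := Xs) (W := 3 * ℓ + 3) fun X hX => by
      have := hXsize X hX; omega
    exact h.trans (Nat.mul_le_mul_right _ hXslen)
  have hfu : 2 ^ ℓ * (3 * ℓ + 3) ≤ 2 ^ ℓ * (3 * ℓ + 4) := Nat.mul_le_mul_left _ (by omega)
  -- (1) the truth table `⊢ A, ¬C₁, …, ¬C_q`
  have htaut : ∀ τ : ℕ → Bool, ∃ X ∈ A :: Xs, X.eval τ = true := by
    intro τ
    rcases hXtaut τ with ⟨X, hX, hXτ⟩ | hAτ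
    · exact ⟨X, List.mem_cons_of_mem _ hX, hXτ⟩
    · exact ⟨A, List.mem_cons_self, hAτ⟩
  have hvars : ∀ X ∈ A :: Xs, ∀ x ∈ X.vars, x ∈ V := by
    intro X hX x hx
    rcases List.mem_cons.1 hX with rfl | hX
    · exact hAvars x hx
    · obtain ⟨c, hc, rfl⟩ := hXmem X hX
      simp only [PropForm.vars] at hx
      obtain ⟨l, hl, rfl⟩ := OntoPHPReduction.exists_of_mem_vars_clauseOf hx
      exact hLcvars c hc l hl
  have hq3 : ∀ X ∈ A :: Xs, X.altDepth ≤ 3 := by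
    intro X hX
    rcases List.mem_cons.1 hX with rfl | hX
    · exact hAdepth
    · obtain ⟨c, -, rfl⟩ := hXmem X hX
      exact altDepth_neg_clauseOf_le c
  have t₀ : BD D B (2 ^ ℓ * ((P + 1 + 2 ^ ℓ * (3 * ℓ + 4)) * (100 * (ℓ + 8) ^ 2) +
      50 * (ℓ + (2 ^ ℓ + 1) + 3) ^ 2 + 2)) (disjList (A :: Xs)) :=
    tautSeqW (A :: Xs) V hVnd hVlen (G := 2 ^ ℓ + 1)
      (by rw [List.length_cons]; omega) hvars htaut hq3 (S₀ := P + 1 + 2 ^ ℓ * (3 * ℓ + 4))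
      (by rw [msum_cons]; nlinarith) (by omega) (by omega)
  -- (2) reorder: negated clauses first, then `A, ¬F`
  have hctx : ∀ X ∈ Xs ++ [A, neg F], X.dd ≤ 5 := by
    intro X hX
    rcases List.mem_append.1 hX with hX | hX
    · exact (hXdd X hX).trans (by norm_num)
    · simp only [List.mem_cons, List.not_mem_nil, or_false] at hX
      rcases hX with rfl | rfl
      · exact hAdd.trans (by norm_num)
      · exact hddnF.trans (by norm_num)
  have hszL' : (disjList (Xs ++ [A, neg F])).size ≤ 2 ^ ℓ * (3 * ℓ + 3) + P + F.size + 4 := by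
    rw [size_disjList_eq_msum, msum_append, msum_cons, msum_cons, msum_nil]
    simp only [size]; omega
  have t₁ : BD D B (2 ^ ℓ * ((P + 1 + 2 ^ ℓ * (3 * ℓ + 4)) * (100 * (ℓ + 8) ^ 2) +
      50 * (ℓ + (2 ^ ℓ + 1) + 3) ^ 2 + 2) + 50 * (2 ^ ℓ + 3 + 1) ^ 2)
      (disjList (Xs ++ [A, neg F])) := by
    refine subsetN (N := 2 ^ ℓ + 3) t₀ ?_ hctx (by omega) ?_ (by rw [List.length_cons]; omega)
      (by rw [List.length_append, List.length_cons, List.length_cons, List.length_nil]; omega)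
    · intro X hX
      rcases List.mem_cons.1 hX with rfl | hX
      · exact List.mem_append_right _ List.mem_cons_self
      · exact List.mem_append_left _ hX
    · rw [size_disjList_eq_msum, msum_cons]
      omega
  -- (3) cut the negated clauses away against `⊢ ¬¬Cᵢ, …`
  have hFmem : ∀ K : List (PropForm ℕ), neg F ∈ K ++ [A, neg F] := fun K =>
    List.mem_append_right _ (List.mem_cons_of_mem _ List.mem_cons_self)
  have hx : ∀ x ∈ Xs, ∀ K, K <:+ Xs →
      BD D B (130 * (F.size + 2) + 50 * (2 ^ ℓ + 3 + 1) ^ 2 + 456)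
        (disjList (neg x :: (K ++ [A, neg F]))) := by
    intro x hx K hK
    obtain ⟨c, hc, rfl⟩ := hXmem x hx
    have hKsub : ∀ X ∈ K, X ∈ Xs := fun X hX => hK.subset hX
    have hKlen : K.length ≤ 2 ^ ℓ := (hK.length_le).trans hXslen
    have hmK : msum K ≤ 2 ^ ℓ * (3 * ℓ + 3) := (msum_le_of_sublist hK.sublist).trans hmsumXs
    refine negNegClauseS (hLcT c hc) hF hTk (K ++ [A, neg F]) (NL := 2 ^ ℓ + 3)
      (by rw [List.length_append, List.length_cons, List.length_cons, List.length_nil]; omega)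
      (hFmem K) (p := 5) ?_ le_rfl (by omega) ?_
    · intro X hX
      rcases List.mem_append.1 hX with hX | hX
      · exact (hXdd X (hKsub X hX)).trans (by norm_num)
      · simp only [List.mem_cons, List.not_mem_nil, or_false] at hX
        rcases hX with rfl | rfl
        · exact hAdd.trans (by norm_num)
        · exact hddnF.trans (by norm_num)
    · rw [msum_append, msum_cons, msum_cons, msum_nil]
      simp only [size]
      omega
  have hs : 2 * (disjList (Xs ++ [A, neg F])).size + 1 ≤ B := by omega
  have fin := elimAllN Xs t₁ hx hs (N := 2 ^ ℓ) hXslen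
  have hrl : rowLines ℓ P F.size =
      2 ^ ℓ * ((P + 1 + 2 ^ ℓ * (3 * ℓ + 4)) * (100 * (ℓ + 8) ^ 2) +
        50 * (ℓ + (2 ^ ℓ + 1) + 3) ^ 2 + 2) + 50 * (2 ^ ℓ + 3 + 1) ^ 2 +
        2 ^ ℓ * (130 * (F.size + 2) + 50 * (2 ^ ℓ + 3 + 1) ^ 2 + 456 + 2) := by
    simp only [rowLines]
    ring
  rw [hrl]
  exact fin

/-- **All rows at once**: `⊢ ⋀_{e ∈ es} parityForm (E e), ¬F`, by conjunction introduction row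
by row (each row's derivation used once). [Shoenfield 1967, §3.1 (case `∧`)] [folklore] -/
theorem rowsFoldS {P : ℕ} (hE : ∀ e, (E e).supp.card ≤ ℓ) (hP : 2 ^ ℓ * (3 * ℓ + 2) + 1 ≤ P)
    (hD : 16 ≤ D)
    (hB : 40 * (P + 2 ^ ℓ * (3 * ℓ + 4) + ℓ) + 16 * (PropForm.ofCNF (sumEncoding 1 E)).size + 600 ≤ B)
    (es : List (Fin m)) (hB' : 8 * (es.length * (P + 1) + 1) + 8 * P + 100 ≤ B) :
    BD D B (es.length * (rowLines ℓ P (PropForm.ofCNF (sumEncoding 1 E)).size + 51) + 500)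
      (disjList [conjList (es.map fun e => parityForm (E e)),
        neg (PropForm.ofCNF (sumEncoding 1 E))]) := by
  have hddnF : (neg (PropForm.ofCNF (sumEncoding 1 E))).dd ≤ 4 := dd_neg_ofCNF_le _
  have hF1 := altDepthAux_le_dd_succ 1 (neg (PropForm.ofCNF (sumEncoding 1 E)))
  induction es with
  | nil =>
    simp only [List.map_nil, conjList_nil, List.length_nil, Nat.zero_mul, Nat.zero_add]
    have t : BD D B 4 (disjList [const true]) := topS (by omega) (by omega)
    refine (subsetN (N := 2) (L' := [const true, neg (PropForm.ofCNF (sumEncoding 1 E))]) t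
      (fun X hX => by rw [List.mem_singleton] at hX; rw [hX]; exact List.mem_cons_self)
      (p := 4) ?_ (by omega) ?_ (by simp) (by simp)).mono (by omega)
    · intro X hX
      simp only [List.mem_cons, List.not_mem_nil, or_false] at hX
      rcases hX with rfl | rfl
      · simp
      · exact hddnF
    · simp only [size_disjList_cons, size_disjList_nil, size]; omega
  | cons e es ih =>
    rw [List.length_cons] at hB' ⊢
    have hkl : es.length * (P + 1) + (P + 1) = (es.length + 1) * (P + 1) := by ring
    have harith : rowLines ℓ P (PropForm.ofCNF (sumEncoding 1 E)).size +
        (es.length * (rowLines ℓ P (PropForm.ofCNF (sumEncoding 1 E)).size + 51) + 500) + 51 ≤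
        (es.length + 1) * (rowLines ℓ P (PropForm.ofCNF (sumEncoding 1 E)).size + 51) + 500 :=
      le_of_eq (by ring)
    have ih' := ih (by omega)
    have hrow := rowS E hE hP hD hB e
    have hM : ∀ X ∈ es.map (fun e => parityForm (E e)), X.size ≤ P := by
      intro X hX
      obtain ⟨e', -, rfl⟩ := List.mem_map.1 hX
      exact (size_parityForm_le_of_le (hE e')).trans hP
    have hKsize := size_conjList_le hM (Q := es.length) (by simp)
    have hKdd : (conjList (es.map fun e => parityForm (E e))).dd ≤ 5 :=
      dd_conjList_le_five fun X hX => by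
        obtain ⟨e', -, rfl⟩ := List.mem_map.1 hX
        exact dd_parityForm_le _
    have hpf := size_parityForm_le_of_le (hE e)
    have fin := consConjS hrow ih' (by have := dd_parityForm_le (E e); omega) (by omega)
      (by rw [disjList_cons, disjList_nil, dd_disj, dd_const]; omega)
      (by simp only [size_disjList_cons, size_disjList_nil, size]; omega)
    rw [List.map_cons, conjList_cons]
    exact fin.mono harith

end GaussFrege

end Rows

end Literature.Computability.MetaComplexity
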